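import Literature.Computability.Cryptography.PQCRingLWE
import HarnessLib

/-!
# The Lyubashevsky–Peikert–Regev main theorem for an arbitrary cyclotomic index (shape)

Topic `Computability/Cryptography`.  Companion of `PQCRingLWE.lean`, whose `LPRMainTheoremStatement`
records the SHAPE of Lyubashevsky–Peikert–Regev, J. ACM 60 (2013) Art. 43, Thm 3.6 ("Ideal-SVP
quantum-hard ⇒ decision Ring-LWE pseudorandom") for the power-of-two cyclotomic family
`K k = ℚ(ζ_{2^k})` only.  The printed theorem is stated for the `m`-th cyclotomic number field for an
ARBITRARY index `m` (Thm 3.6, p. 20, verbatim): "Let `K` be the `m`th cyclotomic number field having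
dimension `n = φ(m)` and `R = O_K` be its ring of integers.  Let `α = α(n) > 0`, and let `q = q(n) ≥ 2`,
`q = 1 mod m` be a `poly(n)`-bounded prime such that `αq ≥ ω(√log n)`.  Then there is a polynomial-time
quantum reduction from `Õ(√n/α)`-approximate `SIVP` (or `SVP`) to `R-DLWE_{q,Υ_α}`.  Alternatively,
for any `ℓ ≥ 1`, we can replace the target problem by the problem of solving `R-DLWE_{q,D_ξ}` given
only `ℓ` samples, where `ξ = α·(nℓ/log(nℓ))^{1/4}`."  For the asymptotics `K` "come[s] from an
infinite sequence of number fields `K = {K_n}` of increasing dimension `n`" (§3, p. 18); here: an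
index family `m : ℕ → ℕ` and `K k = ℚ(ζ_{m k})` (`CyclotomicField (m k) ℚ`) of degree
`n k = φ(m k)` (Mathlib `IsCyclotomicExtension.Rat.finrank`).

## Contents (this file generalises, and CITES rather than restates, the `2^k` family of `PQCRingLWE.lean`)

* `cyclotomicPowerBasisOfIndex m` — the integral power basis `1, ζ_m, …, ζ_m^{φ(m)-1}` of
  `𝓞 (ℚ(ζ_m)) = ℤ[ζ_m]` (Mathlib `IsPrimitiveRoot.integralPowerBasis`, LPR13 Example 2.8), data;
  `cyclotomicPowerBasisOfIndex_dim` (`= φ m`); `cyclotomicPowerBasis_eq_ofIndex`: the tree's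
  `cyclotomicPowerBasis k` IS `cyclotomicPowerBasisOfIndex (2 ^ k)` (`rfl`).
* `CyclotomicRingLWEAssumptionOfIndex m q s ℓ` — the assumption side: the tree's
  `RingLWEDecisionAssumption` for `K k = ℚ(ζ_{m k})` in the power-basis encoding;
  `cyclotomicRingLWEAssumptionOfIndex_two_pow_iff`: at `m k = 2^k` it is the tree's
  `cyclotomicRingLWEAssumption` (`Iff.rfl`).
* `LPRGeneralIndexStatement m` — the shape of Thm 3.6 for the index family `m`, a `def … : Prop`
  (statement level, NOT asserted, NOT proved here, audit below), with the same hypotheses, constants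
  and conclusion as `LPRMainTheoremStatement` and `2^k ↦ m k`, `n k = φ(m k)`;
  `lprGeneralIndexStatement_two_pow_iff : LPRGeneralIndexStatement (fun k => 2 ^ k) ↔
  LPRMainTheoremStatement` (the `2`-power statement is the special case; uses `φ(2^k) = 2^{k-1}` at
  every `k`, a private helper) and the two named directions `LPRGeneralIndexStatement.two_pow` /
  `LPRGeneralIndexStatement.of_two_pow`.
* The worst-case side needs no generalisation: `IdealSVPQuantumHardness K γ` of `PQCRingLWE.lean`
  is already stated for an arbitrary family of number fields `K`.

## Audit against the source (read with the audit (M1)–(M3) in the docstring of `LPRMainTheoremStatement`)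

(G0) Hypotheses and conclusion are those of `LPRMainTheoremStatement` with `2^k ↦ m k` and
`n = φ(m)`: `q k` prime, eventually `q k ≡ 1 (mod m k)` (the printed "`q = 1 mod m`", which makes
`⟨q⟩` split completely, §2.4.1 p. 17), `q ≤ poly(n)` and sample counts `ℓ ≤ poly(n)` (polynomial in
the DEGREE, written `∃ p : Polynomial ℕ, ∀ k, q k ≤ p.eval (n k)`), `α q / √(log n) → ∞`
(= `αq ≥ ω(√log n)`), plus the extra non-triviality hypothesis (i) `0 < α < √(log n / n)` of the
`2^k` file (NOT printed — Thm 3.6 has `α = α(n) > 0` — it only weakens the recorded proposition);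
conclusion `∃ γ = Õ(√n/α)` (`γ(n) ≤ C·(√n/α)·(log n)^e` eventually) with
`IdealSVPQuantumHardness (ℚ(ζ_{m k}))_k γ → CyclotomicRingLWEAssumptionOfIndex m q (n·α·q/√2) ℓ`.
(G1) = (M1): the worst-case instances are bare integer bases isometric to some `σ(𝔞)`
(`RingLWE.IsIdealLatticeInstance`), hiding the ideal that printed `K-SVP_γ` (Def. 2.10, p. 15)
hands the solver — a WEAKER hypothesis, hence a STRONGER recorded implication (unsafe direction).
(G2) = (M2): printed error `Υ_α` (randomised elliptical, Def. 3.5 p. 19) with arbitrarily many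
samples, or spherical `D_ξ`, `ξ = α(nℓ/log(nℓ))^{1/4}`, with `ℓ` samples; recorded: rate-`α`
spherical with `ℓ ≤ poly(n)` samples ("not implied by our worst-case hardness proof", §1.2 p. 6).
(G3) The error model and its normalisation — this is where the index matters.  The tree's Ring-LWE
(`RingLWE.gaussianError`, `RingLWEDecisionAssumption`) is the NON-DUAL form: `a, s ∈ R_q`, spherical
(discretised) Gaussian error on `σ(𝓞 K)`; the printed problem (Def. 3.1/3.3, p. 18) has
`s ∈ R^∨_q` and error on `K_ℝ` modulo the codifferent `R^∨`.  The paper itself prints the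
comparison (p. 19): for `m = 2^k`, `R^∨ = n^{-1}R` and the two variants "are actually equivalent"
(`b ↦ n·b`); "a similar transformation can be performed for all other cyclotomics … by Lemma 2.15.
However, unless `m` is of the form `2^k 3^ℓ`, this transformation necessarily distorts the error
distribution, scaling each coordinate of the canonical embedding by different factors", and (§3.3,
p. 20) taking `a, s ∈ R_q` with spherically bounded error "in certain cases (e.g., the `m`th
cyclotomic for `m = 2^k 3^ℓ`) … is equivalent to the original one, but … in general it leads to a
pure loss … in the provable hardness of the problem for a given spherical error bound (due to the
inherent distortion in mapping `R^∨` to `R`)".  The size of the uniform factor for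
`m = 2^a 3^b` is not printed there; it follows from printed facts: the transformation multiplies by a
(suitable) generator `t ∈ R` of the different ideal, `R^∨ = ⟨t^{-1}⟩` ("a standard fact" for
cyclotomics: Lyubashevsky–Peikert–Regev, *A toolkit for ring-LWE cryptography*, EUROCRYPT 2013,
§2.3, p. 45), so that `x·D_r = D_{r'}` with `r'_i = r_i·|σ_i(t)|` (§2.3.2, p. 12) and
`∏_i |σ_i(t)| = N((R^∨)^{-1}) = Δ_K` (§2.3.6, p. 14); when all `|σ_i(t)|` are equal (p. 19: the case
`m = 2^k 3^ℓ`) they therefore equal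
`Δ_K^{1/n} = m / ∏_{p ∣ m} p^{1/(p-1)}` (discriminant of `ℚ(ζ_m)`, §2.3.5, p. 14), which is `n`
for `m = 2^a` (`n = m/2`; p. 14: "tight … when `m` is a power of two") and `(√3/2)·n` for
`m = 2^a 3^b` with `b ≥ 1` (`n = m/3`, resp. `2m/3` if `a = 0`; this evaluation is ours).  HENCE:
for index families whose members are (eventually) of the form `2^a 3^b`, the recorded normalisation
`s = n·α·q/√2` (tweak by `n`, denominators cleared by `q`, `‖·‖ = ‖·‖_can/√2` on the complex places
of Mathlib's Euclidean mixed space) is the printed one up to a CONSTANT factor in `α`, absorbed by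
`ω(·)/Õ(·)` exactly as in the benign gap (M3) of the `2^k` file; for every other index family the
recorded implication at `s = n·α·q/√2` is NOT a transcription of Thm 3.6 — by the paper's own §3.3
the non-dual spherical problem is provably hard only for a larger spherical bound — so there the
recorded `Prop` asserts MORE than is printed (unsafe direction for consumers, like (G1)).  Of the
conductors named by the consumers of this file, `1536 = 2^9·3` and `3072 = 2^10·3` are of the form
`2^a 3^b`; `2560 = 2^9·5` is not.
(G4) Degenerate families.  For an index family whose degrees `φ(m k)` do not tend to infinity the
hypotheses `0 < α < √(log n / n)`, `q ≤ poly(n)` and `α q/√(log n) → ∞` are jointly unsatisfiable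
(`α q/√(log n)` stays bounded along the bounded-degree subsequence), so the recorded `Prop` holds
vacuously there (no junk truth is asserted about small fields); `m k = 0` is excluded by the
`NeZero` instances (`CyclotomicField 0 ℚ = ℚ` would need separate conventions).  Junk inherited from
the `2^k` file: none new (`φ` replaces the `ℕ`-subtraction `2^(k-1)`; `φ(2^0) = 1 = 2^(0-1)` in `ℕ`,
so the special case is exact at every `k`).

## What is deliberately NOT here

No proof of any form of Thm 3.6 (the recorded statement is a `def`, as its `2^k` special case; net
named-fact debt: one parameterised statement `def`, no `theorem` claimed about it except the
special-case equivalence).  No dual-form (`R^∨`) Ring-LWE model, no `Υ_α`/`D_ξ` error families, no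
`SIVP` variant (it would read verbatim with `IdealSIVPQuantumHardness` of `RingLWEAnyModulus.lean`),
no trace/tensor ("toolkit") presentation of `R^∨` — each would be a definition-first item of its own.

## References

* V. Lyubashevsky, C. Peikert, O. Regev, *On ideal lattices and learning with errors over rings*,
  J. ACM 60 (2013), Art. 43: Thm 3.6 (§3.2, p. 20); Def. 3.1/3.3 (p. 18); Def. 3.5 (§3.1, p. 19);
  the `R^∨` versus `R` discussion (p. 19 and §3.3, pp. 20–21); Example 2.8 (§2.3.4, p. 13);
  discriminant of `ℚ(ζ_m)` (§2.3.5, p. 14); `N((R^∨)^{-1}) = Δ_K` (§2.3.6, p. 14); Def. 2.10 (p. 15);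
  splitting of `q = 1 mod m` (§2.4.1, p. 17). [LyubashevskyPeikertRegev2013JACM]
* V. Lyubashevsky, C. Peikert, O. Regev, *A toolkit for ring-LWE cryptography*, EUROCRYPT 2013,
  LNCS 7881, 35–54: §2.3, p. 45 (`R^∨ = ⟨t^{-1}⟩`). [LyubashevskyPeikertRegev2013Toolkit]
* The `2^k` family and its audit: `Literature.Computability.Cryptography.LPRMainTheoremStatement`
  (`PQCRingLWE.lean`); the any-modulus companion `PRS17MainTheoremShape` (`RingLWEAnyModulus.lean`).
-/

noncomputable section

open scoped NumberField
open Filter NumberField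

namespace Literature.Computability.Cryptography

section PQC

/-! ### The power basis of `ℤ[ζ_m]` for an arbitrary index -/

/-- `φ(2^k) = 2^{k-1}` for EVERY `k : ℕ` (at `k = 0` both sides are `1`, `ℕ`-subtraction);
Mathlib's `Nat.totient_prime_pow` is the case `0 < k`.  This is what makes the `2^k` statement of
`PQCRingLWE.lean` (degree written `2^(k-1)`) literally the special case of the general-index one
(degree written `φ(m k)`).  Private helper (Lyubashevsky–Peikert–Regev 2013, §2.3.6 p. 14: "`m = 2^k` of
degree `n = φ(m) = m/2`", extended to `k = 0` by the `ℕ` conventions). [folklore] -/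
private theorem totient_two_pow_eq_pow_sub_one (k : ℕ) : Nat.totient (2 ^ k) = 2 ^ (k - 1) := by
  rcases Nat.eq_zero_or_pos k with rfl | hk
  · simp
  · rw [Nat.totient_prime_pow Nat.prime_two hk]
    simp

-- Same workaround as `cyclotomicPowerBasis` in `PQCRingLWE.lean` (and Mathlib's
-- `IsCyclotomicExtension.Rat.cyclotomicRing_isIntegralClosure`): the instance
-- `IsCyclotomicExtension {m} ℚ (CyclotomicField m ℚ)` is keyed on `CyclotomicField.algebra`, the
-- goal on `DivisionRing.toRatAlgebra` (defeq, but not at instance transparency).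
set_option backward.isDefEq.respectTransparency false in
/-- The integral power basis `1, ζ_m, …, ζ_m^{φ(m)-1}` of `𝓞 (ℚ(ζ_m)) = ℤ[ζ_m]` for an arbitrary
index `m ≥ 1`: Mathlib's `IsPrimitiveRoot.integralPowerBasis` at
`IsCyclotomicExtension.zeta m ℚ (CyclotomicField m ℚ)`.  Lyubashevsky–Peikert–Regev 2013,
Example 2.8 (§2.3.4, p. 13): for the `m`-th cyclotomic field "the power basis
`{1, ζ_m, …, ζ_m^{n-1}}` of `K` also happens to be an integral basis, i.e., `O_K = ℤ[ζ_m]`" — the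
coefficient encoding `ℤ[X]/(Φ_m(X))` in which a Ring-LWE adversary reads elements of `R_q`.
Generalises the tree's `cyclotomicPowerBasis k` (the case `m = 2^k`, `cyclotomicPowerBasis_eq_ofIndex`).
[cite: LyubashevskyPeikertRegev2013JACM, §2.3.4 Example 2.8] -/
def cyclotomicPowerBasisOfIndex (m : ℕ) [NeZero m] : PowerBasis ℤ (𝓞 (CyclotomicField m ℚ)) :=
  (IsCyclotomicExtension.zeta_spec m ℚ (CyclotomicField m ℚ)).integralPowerBasis

set_option backward.isDefEq.respectTransparency false in -- see `cyclotomicPowerBasisOfIndex`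
/-- The power basis of `ℤ[ζ_m]` has `φ(m)` elements — the degree `n = φ(m)` of `ℚ(ζ_m)` (Mathlib
`IsPrimitiveRoot.integralPowerBasis_dim`; the degree itself is Mathlib's
`IsCyclotomicExtension.Rat.finrank : Module.finrank ℚ K = φ m`, not restated here); Lyubashevsky–
Peikert–Regev 2013, Example 2.8: the power basis `{1, ζ_m, …, ζ_m^{n-1}}`, `n = φ(m)`, is an integral
basis. [cite: LyubashevskyPeikertRegev2013JACM, §2.3.4 Example 2.8] -/
theorem cyclotomicPowerBasisOfIndex_dim (m : ℕ) [NeZero m] :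
    (cyclotomicPowerBasisOfIndex m).dim = Nat.totient m :=
  IsPrimitiveRoot.integralPowerBasis_dim _

/-- The tree's power basis of `ℤ[ζ_{2^k}]` (`cyclotomicPowerBasis k`, `PQCRingLWE.lean`) IS the
general-index power basis at `m = 2^k`, definitionally (Lyubashevsky–Peikert–Regev 2013, Example 2.8
at `m = 2^k`: `ℤ[ζ_{2^k}] = ℤ[X]/(X^{2^{k-1}} + 1)`, §1.1 p. 3).
[cite: LyubashevskyPeikertRegev2013JACM, §2.3.4 Example 2.8 (m = 2^k)] -/
theorem cyclotomicPowerBasis_eq_ofIndex (k : ℕ) :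
    cyclotomicPowerBasis k = cyclotomicPowerBasisOfIndex (2 ^ k) :=
  rfl

/-! ### Decision Ring-LWE over the `m k`-th cyclotomic fields (assumption side) -/

/-- **Decision Ring-LWE over the cyclotomic fields `ℚ(ζ_{m k})`, arbitrary index family** (flag;
Lyubashevsky–Peikert–Regev 2013, §3 Def. 3.3 `R-DLWE`, in the tree's non-dual discretised model —
audit (G3) of the module docstring).  The tree's `RingLWEDecisionAssumption` for
`K k = CyclotomicField (m k) ℚ` (degree `φ(m k)`), elements of `R_q = ℤ_q[X]/(Φ_{m k}(X))` encoded by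
their coefficients in the power basis `cyclotomicPowerBasisOfIndex (m k)`, moduli `q k`, Gaussian
parameters `s k`, sample counts `ℓ k`.  Generalises the tree's `cyclotomicRingLWEAssumption` (the case
`m k = 2^k`, `cyclotomicRingLWEAssumptionOfIndex_two_pow_iff`).
[cite: LyubashevskyPeikertRegev2013JACM, §3 Def. 3.3] -/
def CyclotomicRingLWEAssumptionOfIndex (m : ℕ → ℕ) [∀ k, NeZero (m k)] (q : ℕ → ℕ)
    [∀ k, NeZero (q k)] (s : ℕ → ℝ) (ℓ : ℕ → ℕ) : Prop :=
  RingLWEDecisionAssumption (fun k => CyclotomicField (m k) ℚ)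
    (fun k => (cyclotomicPowerBasisOfIndex (m k)).basis) q s ℓ

/-- At the index family `m k = 2^k` the general-index assumption is the tree's
`cyclotomicRingLWEAssumption`, definitionally (Lyubashevsky–Peikert–Regev 2013, §3 p. 19: the
decision problem "specialized to the `m`th cyclotomic ring for `m = 2^k` (i.e., `R = ℤ[x]/⟨x^n + 1⟩`
for `n = 2^{k-1}`)"). [cite: LyubashevskyPeikertRegev2013JACM, §3 Def. 3.3 (m = 2^k, p. 19)] -/
theorem cyclotomicRingLWEAssumptionOfIndex_two_pow_iff (q : ℕ → ℕ) [∀ k, NeZero (q k)]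
    (s : ℕ → ℝ) (ℓ : ℕ → ℕ) :
    CyclotomicRingLWEAssumptionOfIndex (fun k => 2 ^ k) q s ℓ ↔ cyclotomicRingLWEAssumption q s ℓ :=
  Iff.rfl

/-! ### The main theorem for an arbitrary index family (statement) -/

/-- **Shape of the Lyubashevsky–Peikert–Regev main theorem (J. ACM 60 (2013) Art. 43, Thm 3.6) for
an ARBITRARY cyclotomic index family `m : ℕ → ℕ`**, RECORDED AS A STATEMENT — a `def … : Prop`,
deliberately NOT asserted as a `theorem`, and (audit (G0)–(G4) of the module docstring) a faithful
transcription of the printed theorem only up to the gaps recorded there.  For `K k = ℚ(ζ_{m k})`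
(`CyclotomicField (m k) ℚ`) of degree `n k = φ(m k)`: let `q k` be primes with `q k ≡ 1 (mod m k)`
(eventually) and `q ≤ poly(n)`, sample counts `ℓ ≤ poly(n)`, and `0 < α k < √(log n / n)` with
`α q ≥ ω(√(log n))` (`α q / √(log n) → ∞`).  Then for some approximation factor `γ = Õ(√n / α)`
(`γ n ≤ C (√n/α) (log n)^e` eventually), quantum hardness of `SVP_γ` on ideal lattices of `K k` (the
tree's bare presentation `IdealSVPQuantumHardness`, stated for any family of number fields) implies
the decision Ring-LWE assumption `CyclotomicRingLWEAssumptionOfIndex m q s ℓ` with the spherical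
error parameter `s k = n k · α k · q k / √2`.  Printed (Thm 3.6, p. 20): "`K` the `m`th cyclotomic
number field having dimension `n = φ(m)` … `α = α(n) > 0`, … `q = q(n) ≥ 2`, `q = 1 mod m` a
`poly(n)`-bounded prime such that `αq ≥ ω(√log n)`.  Then there is a polynomial-time quantum
reduction from `Õ(√n/α)`-approximate `SIVP` (or `SVP`) to `R-DLWE_{q,Υ_α}`."  Gaps, in one line
each (details in the module docstring): (G1) bare instances instead of `K-SVP` (stronger than
printed); (G2) rate-`α` spherical error with `poly(n)` samples instead of `Υ_α` / `D_ξ`; (G3) the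
non-dual normalisation `s = n·α·q/√2` matches the printed `R^∨`-form up to constants ONLY for indices
of the form `2^a 3^b` (p. 19, §3.3) — elsewhere the recorded `Prop` asserts more than is printed;
(i) `α < √(log n/n)` is an extra hypothesis.  The `2^k` statement of `PQCRingLWE.lean` is the special
case `m k = 2^k` (`lprGeneralIndexStatement_two_pow_iff`).  Users take
`(h : LPRGeneralIndexStatement m)` for the index family they need (e.g. `fun k => 3 * 2 ^ k`, through
the conductors `1536 = 3·2^9`, `3072 = 3·2^10`; `fun k => 5 * 2 ^ k` through `2560 = 5·2^9`, for which
see (G3)). [cite: LyubashevskyPeikertRegev2013JACM, Thm 3.6] -/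
def LPRGeneralIndexStatement (m : ℕ → ℕ) [∀ k, NeZero (m k)] : Prop :=
  ∀ (q : ℕ → ℕ) (α : ℕ → ℝ) (ℓ : ℕ → ℕ) (hq : ∀ k, (q k).Prime),
    haveI : ∀ k, NeZero (q k) := fun k => ⟨(hq k).ne_zero⟩
    let n : ℕ → ℕ := fun k => Nat.totient (m k)
    (∀ᶠ k in atTop, q k ≡ 1 [MOD m k]) →
    (∃ p : Polynomial ℕ, ∀ k, q k ≤ p.eval (n k)) →
    (∃ p : Polynomial ℕ, ∀ k, ℓ k ≤ p.eval (n k)) →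
    (∀ᶠ k in atTop, 0 < α k ∧ α k < Real.sqrt (Real.log (n k) / n k)) →
    Tendsto (fun k => α k * q k / Real.sqrt (Real.log (n k))) atTop atTop →
    ∃ γ : ℕ → ℝ,
      (∃ C e : ℝ, ∀ᶠ k in atTop, γ (n k) ≤ C * (Real.sqrt (n k) / α k) * Real.log (n k) ^ e) ∧
      (IdealSVPQuantumHardness (fun k => CyclotomicField (m k) ℚ) γ →
        CyclotomicRingLWEAssumptionOfIndex m q (fun k => n k * α k * q k / Real.sqrt 2) ℓ)

/-- **The `2`-power statement is the special case.**  At the index family `m k = 2^k` the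
general-index statement is the tree's `LPRMainTheoremStatement` (`PQCRingLWE.lean`): the two
propositions coincide after rewriting the degree `φ(2^k) = 2^{k-1}` (valid at every `k : ℕ`), the
assumption side being definitionally the same
(`cyclotomicRingLWEAssumptionOfIndex_two_pow_iff`).
[cite: LyubashevskyPeikertRegev2013JACM, Thm 3.6 (m = 2^k)] -/
theorem lprGeneralIndexStatement_two_pow_iff :
    LPRGeneralIndexStatement (fun k => 2 ^ k) ↔ LPRMainTheoremStatement := by
  unfold LPRGeneralIndexStatement LPRMainTheoremStatement
  simp only [totient_two_pow_eq_pow_sub_one]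
  exact Iff.rfl

/-- The tree's `2^k` statement (`LPRMainTheoremStatement`) from the general-index statement at
`m k = 2^k`. [cite: LyubashevskyPeikertRegev2013JACM, Thm 3.6 (m = 2^k)] -/
theorem LPRGeneralIndexStatement.two_pow (h : LPRGeneralIndexStatement (fun k => 2 ^ k)) :
    LPRMainTheoremStatement :=
  lprGeneralIndexStatement_two_pow_iff.1 h

/-- The general-index statement at `m k = 2^k` from the tree's `2^k` statement
(`LPRMainTheoremStatement`). [cite: LyubashevskyPeikertRegev2013JACM, Thm 3.6 (m = 2^k)] -/
theorem LPRGeneralIndexStatement.of_two_pow (h : LPRMainTheoremStatement) :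
    LPRGeneralIndexStatement (fun k => 2 ^ k) :=
  lprGeneralIndexStatement_two_pow_iff.2 h

end PQC

end Literature.Computability.Cryptography

end
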